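import Summits.BirchSwinnertonDyer.BirchSwinnertonDyer.Theorems.KimAtThreeFineKatoPosition
import HarnessLib

/-!
# Crux `KatoKuriharaPortThreeShared` (stmt-BirchSwinnertonDyer-19560) BY NAME from five cite facts ∧ hKatoPos₀
# (cell `bsd-addord`, seat w2-acc4 gen 6; `--supports 19560`, helper)

HONEST FRAMING.  One composition theorem (no definition, no named fact, no instance, no `sorry`): w2-acc4 gen 5's
`KimAtThreeFineKatoCruxOfFacts.katoKuriharaPortThreeShared_of_facts_of_katoV2` (crux ⟸ (S5a) ∧ (S5b-tower) ∧ hKatoV2₀)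
∘ `KimAtThreeFineKatoPosition.katoV2₀_of_katoPos₀_of_facts` (hKatoV2₀ ⟸ (P123) ∧ (DR) ∧ (S5b) ∧ hKatoPos₀).  So, in the
kernel: **crux ⟸ {S5a, S5b, S5b-tower, P123, DR} [cite] ∧ hKatoPos₀**, the displayed residual hKatoPos₀ = «Kato 2004 over
the DEFINED `exp*` of SOME generator of the Néron line, + the 3-adic POSITION of that generator relative to the duality
line» asserting NOTHING of [BK90]/Tate duality.  NOT a closing theorem (hKatoPos₀ displayed; five cite facts as
hypotheses); BSD / 19560 NOT proved by this file; the LEAD (kim3) assembles.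

References: as in `KimAtThreeFineKatoPosition` [Kato2004Asterisque] [Kato1993LNM1553] [BlochKato1990].
-/

noncomputable section

-- the cell's Theorems namespace `Summit.BirchSwinnertonDyer.BirchSwinnertonDyer.…` repeats the summit name by design (D-0017)
set_option linter.dupNamespace false

open scoped Classical NumberField TensorProduct ContRepresentation Pointwise
open Field ValuativeRel Function IsDedekindDomain NumberField WeierstrassCurve Literature.NumberTheory.EllipticCurves
open Literature.NumberTheory.GaloisRepresentations Literature.NumberTheory.GaloisRepresentations.DiscreteGaloisModule
open Literature.NumberTheory.GaloisCohomology Literature.NumberTheory.GaloisRepresentations.PeriodRingData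
open Literature.NumberTheory.PAdicHodge Literature.NumberTheory.EllipticCurves.ModularForms
open Literature.NumberTheory.EllipticCurves.Rank1Residual Literature.NumberTheory.EllipticCurves.Kato2004
open Literature.NumberTheory.EllipticCurves.Kato2004.EulerSystemValues Literature.NumberTheory.AdelicBaseChange
open Literature.NumberTheory.Automorphic Summit.BirchSwinnertonDyer.Rank1Residual.GaloisImage
open Summit.BirchSwinnertonDyer.Rank1Residual.Additive.LocalLog Summit.BirchSwinnertonDyer.BirchSwinnertonDyer.Theorems
open KimAtThreeFineKatoPerFactorDefined KimAtThreeDeepLowerExpStarOmega KimAtThreeDeepLowerExpStarOmegaPlace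
open KimAtThreeFineKatoPerFactorPlaces KimAtThreeDeepUpperExpStarFacts KimAtThreeDeepUpperExpStarFactsCanonical
open KimAtThreeDeepLowerZetaBodyRatScaling KimAtThreeFineKatoOuterRescale KimAtThreeFineKatoPosition

namespace Summit.BirchSwinnertonDyer.BirchSwinnertonDyer.Theorems.KimAtThreeFineKatoPositionCrux

set_option backward.isDefEq.respectTransparency false in
set_option maxHeartbeats 800000 in
/-- **Crux `KatoKuriharaPortThreeShared` (stmt-BirchSwinnertonDyer-19560) BY NAME from the five cite facts (S5a),
(S5b-tower), (P123), (DR), (S5b) and the displayed hKatoPos₀** («Kato-only ∧ position», no duality assertion):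
`katoKuriharaPortThreeShared_of_facts_of_katoV2 hA hTow (katoV2₀_of_katoPos₀_of_facts hP hDR hT hKatoPos₀)`.
NOT a closing theorem (hKatoPos₀ displayed; five cite facts as hypotheses).
[cite: Kato2004Asterisque, (8.1.3) (p. 180), Prop. 8.12 (p. 186), §9.4 and Thm. 9.7 (pp. 188–189), Thm. 16.6.2, Ex. 13.3 (pp. 224–225)]
[cite: BlochKato1990, §3 (Prop. 3.8, Ex. 3.11)] [cite: Kato1993LNM1553, Ch. II Prop. 1.2.3, §1.2.4 and Thm. 1.4.1] -/
theorem katoKuriharaPortThreeShared_of_facts_of_katoPos (hA : expStarCoord_eq_zero_iff_kummer)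
    (hTow : exists_smul_range_expStarCoord_tower_iff_trace_log)
    (hP : cupLogInjective_and_hasDualExp_of_isDeRham)
    (hDR : isDeRham_restrictedRationalTateRep) (hT : exists_smul_range_expStarCoord_iff_trace_log)
    (hKatoPos₀ : ∀ (W : WeierstrassCurve ℚ) [W.IsElliptic] [W.IsGloballyMinimal]
      [ContinuousSMul ℤ_[3] (W.tateModule 3)] [Module.Free ℤ_[3] (W.tateModule 3)]
      [Module.Finite ℤ_[3] (W.tateModule 3)],
      (∀ m : ℕ, W.HasSurjectiveModNGaloisRep (3 ^ m : ℕ)) →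
      (haveI : Fact (Nat.Prime 3) := ⟨Nat.prime_three⟩; Addv W 3) →
      ¬ 3 ∣ (W.baseChange ℚ_[3]).localTamagawaNumber ℤ_[3] →
      Nat.card {Q : (W.baseChange ℚ_[3]).toAffine.Point // (3 : ℕ) • Q = 0} = 1 →
      ∀ {N : ℕ} [NeZero N] (P : ModularParametrizationData W N), N = W.conductorNorm ℤ →
        (∀ z ∈ P.L.lattice, ∃ w ∈ periodLattice P.f, z = P.c * w) →
        ¬ (3 : ℤ) ∣ P.maninConstant →
        haveI : Fact (((3 : ℕ) : 𝓞 ℚ) ∈ ((Rat.HeightOneSpectrum.primesEquiv (R := 𝓞 ℚ)).symm ⟨3, Fact.out⟩).asIdeal) :=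
          ⟨(natCast_mem_asIdeal_iff_eq_primesEquiv_symm _ Nat.prime_three).mpr rfl⟩
        letI := valuativeRelPlace ((Rat.HeightOneSpectrum.primesEquiv (R := 𝓞 ℚ)).symm ⟨3, Fact.out⟩)
        letI := topologicalSpacePlace ((Rat.HeightOneSpectrum.primesEquiv (R := 𝓞 ℚ)).symm ⟨3, Fact.out⟩)
        haveI := isNonarchimedeanLocalField_place ((Rat.HeightOneSpectrum.primesEquiv (R := 𝓞 ℚ)).symm ⟨3, Fact.out⟩)
        haveI := charZero_place ((Rat.HeightOneSpectrum.primesEquiv (R := 𝓞 ℚ)).symm ⟨3, Fact.out⟩)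
        letI := padicAlgebraPlace 3 ((Rat.HeightOneSpectrum.primesEquiv (R := 𝓞 ℚ)).symm ⟨3, Fact.out⟩)
        haveI := fact_not_isUnit_place 3 ((Rat.HeightOneSpectrum.primesEquiv (R := 𝓞 ℚ)).symm ⟨3, Fact.out⟩)
        haveI := isAdicComplete_place 3 ((Rat.HeightOneSpectrum.primesEquiv (R := 𝓞 ℚ)).symm ⟨3, Fact.out⟩)
        ∃ (d : LocalNeronLineAt W 3 ((Rat.HeightOneSpectrum.primesEquiv (R := 𝓞 ℚ)).symm ⟨3, Fact.out⟩)),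
        ∃ (ι : (n : ℕ) → (CyclotomicField n ℚ →+* ℂ)) (κK : ℝ)
          (Λ : ∀ (k' : ℕ) (r : Finset (HeightOneSpectrum (𝓞 ℚ))),
            H1 (tateRep W 3) (cycSubgroup 3 k' r) →ₗ[ℤ_[3]]
              ℚ_[3] ⊗[ℚ] CyclotomicField (cycLevel 3 k' r) ℚ),
          κK ≠ 0 ∧
          (∃ u : ℚ, (u : ℝ) = κK ∧
            ∀ (hinj : (bdRPeriodRingData (valuation_place_lt_one 3 ((Rat.HeightOneSpectrum.primesEquiv (R := 𝓞 ℚ)).symm ⟨3, Fact.out⟩))).CupLogInjective (logCyclotomic 3)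
            (localRationalTateRep W 3 (galRestrictPlace ((Rat.HeightOneSpectrum.primesEquiv (R := 𝓞 ℚ)).symm ⟨3, Fact.out⟩))))
            (hex : ∀ z : contOneCocycles (localRationalTateRep W 3 (galRestrictPlace ((Rat.HeightOneSpectrum.primesEquiv (R := 𝓞 ℚ)).symm ⟨3, Fact.out⟩))).toTopRep,
            (bdRPeriodRingData (valuation_place_lt_one 3 ((Rat.HeightOneSpectrum.primesEquiv (R := 𝓞 ℚ)).symm ⟨3, Fact.out⟩))).HasDualExp (logCyclotomic 3)
            (localRationalTateRep W 3 (galRestrictPlace ((Rat.HeightOneSpectrum.primesEquiv (R := 𝓞 ℚ)).symm ⟨3, Fact.out⟩))) fun σ => z.1 σ)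
              (e : ((Rat.HeightOneSpectrum.primesEquiv (R := 𝓞 ℚ)).symm ⟨3, Fact.out⟩).adicCompletion ℚ) (he : e ≠ 0),
              (∀ a : ℚ_[3], (∃ y, (expStarOmegaPadicAt (d.smul e he) hinj hex (((Padic.adicCompletionEquiv (𝓞 ℚ) ⟨3, Fact.out⟩).symm : (((Rat.HeightOneSpectrum.primesEquiv (R := 𝓞 ℚ)).symm ⟨3, Fact.out⟩).adicCompletion ℚ) →+* ℚ_[3]))) y = a) ↔
                ∀ Q : (W.baseChange ℚ_[3]).toAffine.Point, ‖a * padicLog (W.baseChange ℚ_[3]) Q‖ ≤ 1) →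
              padicValRat 3 u = ((((Padic.adicCompletionEquiv (𝓞 ℚ) ⟨3, Fact.out⟩).symm : (((Rat.HeightOneSpectrum.primesEquiv (R := 𝓞 ℚ)).symm ⟨3, Fact.out⟩).adicCompletion ℚ) →+* ℚ_[3])) e).valuation) ∧
          (∀ (j : ℕ) (r : Finset (HeightOneSpectrum (𝓞 ℚ)))
            (Ψ : ℚ_[3] ⊗[ℚ] CyclotomicField (cycLevel 3 0 r) ℚ ≃ₐ[ℚ]
              (Π w : ((Rat.HeightOneSpectrum.primesEquiv (R := 𝓞 ℚ)).symm ⟨3, Fact.out⟩).Extension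
                (𝓞 (CyclotomicField (cycLevel 3 0 r) ℚ)), w.1.adicCompletion (CyclotomicField (cycLevel 3 0 r) ℚ)))
            (hΨ : ∀ (s : ℚ_[3]) (x : CyclotomicField (cycLevel 3 0 r) ℚ)
              (w : ((Rat.HeightOneSpectrum.primesEquiv (R := 𝓞 ℚ)).symm ⟨3, Fact.out⟩).Extension
                (𝓞 (CyclotomicField (cycLevel 3 0 r) ℚ))),
              Ψ (s ⊗ₜ[ℚ] x) w =
                algebraMap (CyclotomicField (cycLevel 3 0 r) ℚ) (w.1.adicCompletion (CyclotomicField (cycLevel 3 0 r) ℚ)) x *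
                algebraMap (((Rat.HeightOneSpectrum.primesEquiv (R := 𝓞 ℚ)).symm ⟨3, Fact.out⟩).adicCompletion ℚ)
                  (w.1.adicCompletion (CyclotomicField (cycLevel 3 0 r) ℚ)) ((Padic.adicCompletionEquiv (𝓞 ℚ) ⟨3, Fact.out⟩) s)),
            ∃ (w₀ : ((Rat.HeightOneSpectrum.primesEquiv (R := 𝓞 ℚ)).symm ⟨3, Fact.out⟩).Extension
                (𝓞 (CyclotomicField (cycLevel 3 0 r) ℚ)))
              (g : ((Rat.HeightOneSpectrum.primesEquiv (R := 𝓞 ℚ)).symm ⟨3, Fact.out⟩).Extension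
                (𝓞 (CyclotomicField (cycLevel 3 0 r) ℚ)) → absoluteGaloisGroup ℚ)
              (hg : ∀ w : ((Rat.HeightOneSpectrum.primesEquiv (R := 𝓞 ℚ)).symm ⟨3, Fact.out⟩).Extension
                (𝓞 (CyclotomicField (cycLevel 3 0 r) ℚ)),
                sigma (cycLevel 3 0 r) (modNCyclotomicCharacter ℚ (cycLevel 3 0 r) (g w)) • w.1 = w₀.1),
                letI := LocalField.charZero_adicCompletion w₀.1
                letI := LocalField.adicCompletionPadicAlgebra w₀.1 3 (three_mem_asIdeal_extension _ w₀)
                haveI : Fact (¬ IsUnit ((3 : ℕ) : integerC (w₀.1.adicCompletion (CyclotomicField (cycLevel 3 0 r) ℚ)))) :=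
                  ⟨not_isUnit_natCast_integerC (LocalField.valuation_adicCompletion_natCast_lt_one w₀.1 3 (three_mem_asIdeal_extension _ w₀))⟩
                haveI := isAdicComplete_integerC_natCast (LocalField.valuation_adicCompletion_natCast_lt_one w₀.1 3 (three_mem_asIdeal_extension _ w₀))
                ∃ (dw : LocalNeronLine W (LocalField.valuation_adicCompletion_natCast_lt_one w₀.1 3 (three_mem_asIdeal_extension _ w₀))
                  ((galRestrictPlace ((Rat.HeightOneSpectrum.primesEquiv (R := 𝓞 ℚ)).symm ⟨3, Fact.out⟩)).comp
                    (absGaloisRestrict (((Rat.HeightOneSpectrum.primesEquiv (R := 𝓞 ℚ)).symm ⟨3, Fact.out⟩).adicCompletion ℚ) (w₀.1.adicCompletion (CyclotomicField (cycLevel 3 0 r) ℚ)))))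
                  (hinjw : (bdRPeriodRingData (LocalField.valuation_adicCompletion_natCast_lt_one w₀.1 3 (three_mem_asIdeal_extension _ w₀))).CupLogInjective
                  (logCyclotomic 3) (localRationalTateRep W 3 ((galRestrictPlace ((Rat.HeightOneSpectrum.primesEquiv (R := 𝓞 ℚ)).symm ⟨3, Fact.out⟩)).comp
                    (absGaloisRestrict (((Rat.HeightOneSpectrum.primesEquiv (R := 𝓞 ℚ)).symm ⟨3, Fact.out⟩).adicCompletion ℚ) (w₀.1.adicCompletion (CyclotomicField (cycLevel 3 0 r) ℚ))))))
                  (hexw : ∀ z : contOneCocycles (localRationalTateRep W 3 ((galRestrictPlace ((Rat.HeightOneSpectrum.primesEquiv (R := 𝓞 ℚ)).symm ⟨3, Fact.out⟩)).comp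
                    (absGaloisRestrict (((Rat.HeightOneSpectrum.primesEquiv (R := 𝓞 ℚ)).symm ⟨3, Fact.out⟩).adicCompletion ℚ) (w₀.1.adicCompletion (CyclotomicField (cycLevel 3 0 r) ℚ))))).toTopRep,
                  (bdRPeriodRingData (LocalField.valuation_adicCompletion_natCast_lt_one w₀.1 3 (three_mem_asIdeal_extension _ w₀))).HasDualExp
                    (logCyclotomic 3) (localRationalTateRep W 3 ((galRestrictPlace ((Rat.HeightOneSpectrum.primesEquiv (R := 𝓞 ℚ)).symm ⟨3, Fact.out⟩)).comp
                    (absGaloisRestrict (((Rat.HeightOneSpectrum.primesEquiv (R := 𝓞 ℚ)).symm ⟨3, Fact.out⟩).adicCompletion ℚ) (w₀.1.adicCompletion (CyclotomicField (cycLevel 3 0 r) ℚ))))) fun σ => z.1 σ),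
                  (∀ (h : (tateLocalRep W 3 (Sum.inr ((Rat.HeightOneSpectrum.primesEquiv (R := 𝓞 ℚ)).symm ⟨3, Fact.out⟩))).cohomology 1),
                  (expStarOmegaHom (LocalField.valuation_adicCompletion_natCast_lt_one w₀.1 3 (three_mem_asIdeal_extension _ w₀))
                    ((galRestrictPlace ((Rat.HeightOneSpectrum.primesEquiv (R := 𝓞 ℚ)).symm ⟨3, Fact.out⟩)).comp
                    (absGaloisRestrict (((Rat.HeightOneSpectrum.primesEquiv (R := 𝓞 ℚ)).symm ⟨3, Fact.out⟩).adicCompletion ℚ) (w₀.1.adicCompletion (CyclotomicField (cycLevel 3 0 r) ℚ)))) dw hinjw hexw)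
                    (ContinuousRep.cohomologyRes (tateLocalRep W 3 (Sum.inr ((Rat.HeightOneSpectrum.primesEquiv (R := 𝓞 ℚ)).symm ⟨3, Fact.out⟩)))
                      (absGaloisRestrict (((Rat.HeightOneSpectrum.primesEquiv (R := 𝓞 ℚ)).symm ⟨3, Fact.out⟩).adicCompletion ℚ) (w₀.1.adicCompletion (CyclotomicField (cycLevel 3 0 r) ℚ))) 1 h) =
                  algebraMap (((Rat.HeightOneSpectrum.primesEquiv (R := 𝓞 ℚ)).symm ⟨3, Fact.out⟩).adicCompletion ℚ) (w₀.1.adicCompletion (CyclotomicField (cycLevel 3 0 r) ℚ)) (expStarOmegaAt d h)) ∧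
                  (∀ (w : ((Rat.HeightOneSpectrum.primesEquiv (R := 𝓞 ℚ)).symm ⟨3, Fact.out⟩).Extension
                    (𝓞 (CyclotomicField (cycLevel 3 0 r) ℚ)))
                  (y : H1 (tateRep W 3) (cycSubgroup 3 0 r))
                  (φ'' : contOneCocycles (subgroupRep (tateRep W 3).toTopRep (cycSubgroup 3 0 r)))
                  (ψT : contOneCocycles ((tateLocalRep W 3 (Sum.inr ((Rat.HeightOneSpectrum.primesEquiv (R := 𝓞 ℚ)).symm ⟨3, Fact.out⟩))).restrict
                    (absGaloisRestrict (((Rat.HeightOneSpectrum.primesEquiv (R := 𝓞 ℚ)).symm ⟨3, Fact.out⟩).adicCompletion ℚ) (w₀.1.adicCompletion (CyclotomicField (cycLevel 3 0 r) ℚ)))).toTopRep),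
                  oneCocycleClass _ φ'' = conjMap (tateRep W 3).toTopRep (cycSubgroup 3 0 r) (g w) 1 y →
                  (∀ σ, ψT.1 σ = φ''.1 ⟨absGaloisRestrictTower ℚ (((Rat.HeightOneSpectrum.primesEquiv (R := 𝓞 ℚ)).symm ⟨3, Fact.out⟩).adicCompletion ℚ) (w₀.1.adicCompletion (CyclotomicField (cycLevel 3 0 r) ℚ)) σ,
                    absGaloisRestrictTower_adicCompletion_mem_cycSubgroup r w₀ σ⟩) →
                  Ψ (Λ 0 r y) w = galAdicCompletionMap
                    (sigma (cycLevel 3 0 r) (modNCyclotomicCharacter ℚ (cycLevel 3 0 r) (g w)))⁻¹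
                    (inv_smul_eq_of_smul_eq (hg w))
                    ((expStarOmegaHom (LocalField.valuation_adicCompletion_natCast_lt_one w₀.1 3 (three_mem_asIdeal_extension _ w₀))
                    ((galRestrictPlace ((Rat.HeightOneSpectrum.primesEquiv (R := 𝓞 ℚ)).symm ⟨3, Fact.out⟩)).comp
                    (absGaloisRestrict (((Rat.HeightOneSpectrum.primesEquiv (R := 𝓞 ℚ)).symm ⟨3, Fact.out⟩).adicCompletion ℚ) (w₀.1.adicCompletion (CyclotomicField (cycLevel 3 0 r) ℚ)))) dw hinjw hexw) (oneCocycleClass _ ψT)))) ∧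
          ∀ (c d a : ℤ) (A : ℕ), 0 < A → Int.gcd c (6 * 3 * A) = 1 → Int.gcd d (6 * 3 * N) = 1 →
            ∃ (z : ∀ (k' : ℕ) (r : (cyclotomicLevelsRat 3 (badPlaces c d A N)).Ideals),
                  H1 (tateRep W 3) ((cyclotomicLevelsRat 3 (badPlaces c d A N)).level k' r.1))
              (x : ∀ (k' : ℕ) (r : (cyclotomicLevelsRat 3 (badPlaces c d A N)).Ideals),
                  CyclotomicField (cycLevel 3 k' r.1) ℚ),
              ZetaBody W 3 P.f ι κK Λ c d a A z x) :
    Summit.BirchSwinnertonDyer.BirchSwinnertonDyer.Theses.KimAtThreeKolyvagin.KatoKuriharaPortThreeShared :=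
  KimAtThreeFineKatoCruxOfFacts.katoKuriharaPortThreeShared_of_facts_of_katoV2 hA hTow
    (katoV2₀_of_katoPos₀_of_facts hP hDR hT hKatoPos₀)

end Summit.BirchSwinnertonDyer.BirchSwinnertonDyer.Theorems.KimAtThreeFineKatoPositionCrux

end
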